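import Mathlib
import HarnessLib
import Literature.Probability.MarkovChains.SpectralProfile
import Literature.Probability.MarkovChains.RestrictedCheegerInequality

/-!
# Comparisons for the spectral profile: `λ₀(S) ≤ λ(S) ≤ λ₀(S)/(1 − π(S))`, `λ₁ ≤ Λ(1/2) ≤ 2λ₁` and `Λ(r) ≤ Φ(r)/(1 − r)` (Goel–Montenegro–Tetali 2006, eq. (lambda_0), Lemmas 2.2–2.4)

HONEST FRAMING: exact (Metropolis-corrected) sampling algorithms for lattice gauge theory; figures
of merit are autocorrelation/cost numbers at stated couplings and volumes; no continuum-physics claim.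

Source (READ on the hub's materialised text): S. Goel, R. Montenegro, P. Tetali, *Mixing time
bounds via the spectral profile*, Electron. J. Probab. **11** (2006) 1–26 = math.PR/0505690
[GoelMontenegroTetali2006] (held text `paper:arxiv-math_0505690`: §1.2, §2.1 "Spectral profile
bounds", §2.2 "Conductance bounds").  Everything below is PROVED (finite state space; 0 named
facts).  Vocabulary of `SpectralProfile.lean`: `λ(S) = dirichletEigenvalue π P S`, `λ₀(S) =
dirichletEigenvalue₀ π P S`, `Λ(r) = spectralProfile π P r`, `𝓔 = dirichletForm π P`, `Var =
lawVariance π`, `‖f‖₂² = piInner π f f`, `λ₁ = spectralGapR π P`, `Q(A,B) = edgeMeasure π P A B`,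
`|∂S|/π(S) = bottleneckRatio π P S` (`BottleneckRatio.lean`), `π(S) = Σ_{x∈S} π(x)`.

## Content
* §2.1 **LEMMA 2.3**: `dirichletForm_posPart_add_dirichletForm_min_le` (`𝓔(f,f) ≥ 𝓔(f₊,f₊) + 𝓔(f₋,f₋)`, the negative
  part typed as `min(f,0) = −f₋`; `𝓔(f,f) ≥ 𝓔(f₊,f₊)` is `dirichletForm_posPart_le` of
  `SpectralProfile.lean`, `𝓔(f,f) ≥ 𝓔(|f|,|f|)` is `dirichletForm_abs_le` of
  `RestrictedCheegerInequality.lean`).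
* §1.2 eq. (lambda_0) **`λ₀(S) ≤ λ(S) ≤ λ₀(S)/(1 − π(S))`** (`dirichletEigenvalue₀_le_dirichletEigenvalue`,
  `one_sub_mul_dirichletEigenvalue_le`), with the printed ingredients `Var(f) ≤ ‖f‖₂²`, `𝓔(f,f) ≥
  𝓔(|f|,|f|)` and Cauchy–Schwarz `‖f‖₁ ≤ ‖f‖₂√π(S)` (`lawMean_abs_sq_le`).
* §2.1 **LEMMA 2.2** `GoelMontenegroTetali2006_lemma_2_2_lower` / `_upper`: **`λ₁ ≤ Λ(1/2) ≤ 2λ₁`**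
  (`|X| ≥ 2`), via a `π`-median (`exists_median` of `CheegerInequality.lean`) and the Poincaré form
  `lawVariance_mul_spectralProfile_half_le` (`𝓔(f,f) ≥ Var(f)Λ(1/2)/2` for every `f`).
* §2.2 **DEFINITION 2.2** `conductanceProfile π P r = Φ(r) = inf{|∂S|/π(S) : S ≠ ∅, π(S) ≤ r}`;
  `dirichletForm_setIndicator` (`𝓔(1_A,1_A) = ½(Q(A,Aᶜ) + Q(Aᶜ,A))`),
  `dirichletEigenvalue₀_le_edgeMeasure_div` (`λ₀(A) ≤ |∂A|/π(A)`) and **LEMMA 2.4, upper bound**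
  `GoelMontenegroTetali2006_lemma_2_4_upper`: **`Λ(r) ≤ Φ(r)/(1 − r)`**.

NOT HERE (scope, value-free): the lower bound `Φ(r)²/2 ≤ Λ(r)` of LEMMA 2.4 (restricted Cheeger
inequality via the co-area formula); the integrated THEOREMS 2.1 / 1.1; §2.3, §3–§6.  Context (cell
pub-lqcd, venture LatticeQCDFlow; value-free): LEMMA 2.2 says the spectral profile can improve on
the spectral gap only through sets of mass `< 1/2`; LEMMA 2.4 ties it to the conductance profile.
-/

namespace Literature.Probability.MarkovChains

open Finset Matrix

variable {X : Type*} [Fintype X] {P : Matrix X X ℝ} {π : X → ℝ}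

/-! ## §1.2 eq. (lambda_0) and Lemma 2.2: `λ₀(S) ≤ λ(S) ≤ λ₀(S)/(1 − π(S))`, `λ₁ ≤ Λ(1/2) ≤ 2λ₁` -/

section Comparison

/-- **LEMMA 2.3 (Goel–Montenegro–Tetali 2006), first inequality: `𝓔(f,f) ≥ 𝓔(f₊,f₊) + 𝓔(f₋,f₋)`**,
typed with `f₊ = max(f,0)` and `−f₋ = min(f,0)` (`𝓔` is even, `𝓔(f₋) = 𝓔(min(f,0))`).
[cite: GoelMontenegroTetali2006, §2.1 Lemma 2.3] -/
theorem dirichletForm_posPart_add_dirichletForm_min_le (hπ0 : ∀ x, 0 ≤ π x)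
    (hP0 : ∀ x y, 0 ≤ P x y) (f : X → ℝ) :
    dirichletForm π P (fun x => max (f x) 0) + dirichletForm π P (fun x => min (f x) 0) ≤
      dirichletForm π P f := by
  unfold dirichletForm
  rw [← mul_add, ← sum_add_distrib]
  refine mul_le_mul_of_nonneg_left (sum_le_sum fun x _ => ?_) (by norm_num)
  rw [← sum_add_distrib]
  refine sum_le_sum fun y _ => ?_
  rw [← mul_add]
  refine mul_le_mul_of_nonneg_left ?_ (mul_nonneg (hπ0 x) (hP0 x y))
  -- `(a₊ − b₊)² + (a₋' − b₋')² ≤ (a − b)²` with `a = a₊ + a₋'`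
  rcases le_total 0 (f x) with hx | hx <;> rcases le_total 0 (f y) with hy | hy <;>
    simp [hx, hy] <;> nlinarith

/-- `Var_π(f) ≤ ‖f‖₂²`. [cite: GoelMontenegroTetali2006, §1.2 (the Courant–Fischer display:
`𝓔/‖f‖₂² ≤ 𝓔/Var(f)`)] -/
theorem lawVariance_le_piInner (hπ1 : ∑ x, π x = 1) (f : X → ℝ) :
    lawVariance π f ≤ piInner π f f := by
  rw [piInner_self_eq_lawVariance_add_sq hπ1 f]
  nlinarith [sq_nonneg (lawMean π f)]

/-- **`λ₀(S) ≤ λ(S)`** (non-empty `S`, `|X| ≥ 2`): "The lower bound is due to the identity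
`𝓔_K(f,f) = 𝓔_{K_S}(f,f)` when `f ∈ c₀(S)`" and `Var(f) ≤ ‖f‖₂²`.
[cite: GoelMontenegroTetali2006, §1.2 eq. (lambda_0), lower bound] -/
theorem dirichletEigenvalue₀_le_dirichletEigenvalue [Nontrivial X] [DecidableEq X]
    (hπ : ∀ x, 0 < π x) (hπ1 : ∑ x, π x = 1) (hP0 : ∀ x y, 0 ≤ P x y) {S : Finset X}
    (hS : S.Nonempty) : dirichletEigenvalue₀ π P S ≤ dirichletEigenvalue π P S := by
  have hπ0 : ∀ x, 0 ≤ π x := fun x => (hπ x).le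
  obtain ⟨f₀, hf₀⟩ := exists_mem_c0plus hπ hπ1 hS
  refine le_csInf ⟨_, ⟨f₀, hf₀, rfl⟩⟩ ?_
  rintro _ ⟨f, ⟨hsupp, -, hV⟩, rfl⟩
  have hff : 0 < piInner π f f := lt_of_lt_of_le hV (lawVariance_le_piInner hπ1 f)
  rw [le_div_iff₀ hV]
  calc dirichletEigenvalue₀ π P S * lawVariance π f
      ≤ dirichletEigenvalue₀ π P S * piInner π f f :=
        mul_le_mul_of_nonneg_left (lawVariance_le_piInner hπ1 f) (dirichletEigenvalue₀_nonneg hπ0 hP0 S)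
    _ ≤ dirichletForm π P f := dirichletEigenvalue₀_mul_piInner_le hπ0 hP0 hsupp

/-- Cauchy–Schwarz on the support: `(E_π|f|)² ≤ π(S)‖f‖₂²` for `f` supported in `S`
("Cauchy-Schwartz gives `‖f‖₁ ≤ ‖f‖₂√π(S)`"). [cite: GoelMontenegroTetali2006, §1.2 (after eq.
(lambda_0))] -/
theorem lawMean_abs_sq_le [DecidableEq X] (hπ0 : ∀ x, 0 ≤ π x) {S : Finset X} {f : X → ℝ}
    (hsupp : ∀ x, x ∉ S → f x = 0) :
    lawMean π (fun x => |f x|) ^ 2 ≤ (∑ x ∈ S, π x) * piInner π f f := by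
  -- `E|f| = ⟨1_S, |f|⟩_π`
  have e1 : lawMean π (fun x => |f x|) = piInner π (fun x => if x ∈ S then (1:ℝ) else 0) (fun x => |f x|) := by
    unfold lawMean piInner
    refine sum_congr rfl fun x _ => ?_
    dsimp only
    by_cases hx : x ∈ S
    · rw [if_pos hx, one_mul]
    · rw [if_neg hx, hsupp x hx, abs_zero]; ring
  have e2 : piInner π (fun x => if x ∈ S then (1:ℝ) else 0) (fun x => if x ∈ S then (1:ℝ) else 0) =
      ∑ x ∈ S, π x := by
    unfold piInner
    rw [← sum_filter_add_sum_filter_not univ (fun x => x ∈ S)]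
    have h1 : ∑ x ∈ univ.filter (fun x => x ∈ S), π x * ((if x ∈ S then (1:ℝ) else 0) * (if x ∈ S then 1 else 0))
        = ∑ x ∈ S, π x := by
      rw [show univ.filter (fun x => x ∈ S) = S by ext; simp]
      exact sum_congr rfl fun x hx => by rw [if_pos hx]; ring
    have h2 : ∑ x ∈ univ.filter (fun x => ¬ x ∈ S), π x * ((if x ∈ S then (1:ℝ) else 0) * (if x ∈ S then 1 else 0)) = 0 :=
      sum_eq_zero fun x hx => by rw [if_neg (mem_filter.1 hx).2]; ring
    rw [h1, h2, add_zero]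
  have e3 : piInner π (fun x => |f x|) (fun x => |f x|) = piInner π f f := by
    unfold piInner; exact sum_congr rfl fun x _ => by rw [← sq, sq_abs, sq]
  rw [e1]
  have h := piInner_sq_le_mul hπ0 (fun x => if x ∈ S then (1:ℝ) else 0) (fun x => |f x|)
  rw [e2, e3] at h
  exact h

/-- **`λ(S) ≤ λ₀(S)/(1 − π(S))`, typed as `(1 − π(S))λ(S) ≤ λ₀(S)`** (non-empty `S`): for
`f ∈ c₀(S)`, `𝓔(f,f) ≥ 𝓔(|f|,|f|)` and `Var(|f|) ≥ (1 − π(S))‖f‖₂²`.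
[cite: GoelMontenegroTetali2006, §1.2 eq. (lambda_0), upper bound] -/
theorem one_sub_mul_dirichletEigenvalue_le [DecidableEq X] (hπ : ∀ x, 0 < π x)
    (hπ1 : ∑ x, π x = 1) (hP0 : ∀ x y, 0 ≤ P x y) {S : Finset X} (hS : S.Nonempty) :
    (1 - ∑ x ∈ S, π x) * dirichletEigenvalue π P S ≤ dirichletEigenvalue₀ π P S := by
  have hπ0 : ∀ x, 0 ≤ π x := fun x => (hπ x).le
  -- the index set of `λ₀(S)` is non-empty: the indicator of a point of `S`
  obtain ⟨x₀, hx₀⟩ := hS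
  have hne : ∃ f : X → ℝ, (∀ x, x ∉ S → f x = 0) ∧ 0 < piInner π f f := by
    refine ⟨fun x => if x = x₀ then 1 else 0, fun x hx => if_neg (fun h : x = x₀ => hx (by rw [h]; exact hx₀)), ?_⟩
    have : piInner π (fun x => if x = x₀ then (1:ℝ) else 0) (fun x => if x = x₀ then (1:ℝ) else 0) = π x₀ := by
      simp [piInner]
    rw [this]; exact hπ x₀
  obtain ⟨f₀, hf₀⟩ := hne
  refine le_csInf ⟨_, ⟨f₀, hf₀, rfl⟩⟩ ?_
  rintro _ ⟨f, ⟨hsupp, hff⟩, rfl⟩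
  rw [le_div_iff₀ hff]
  have hlam0 : 0 ≤ dirichletEigenvalue π P S := dirichletEigenvalue_nonneg hπ0 hP0 S
  -- `Var(|f|) ≥ ‖f‖² − π(S)‖f‖²`
  have hVabs : (1 - ∑ x ∈ S, π x) * piInner π f f ≤ lawVariance π (fun x => |f x|) := by
    have h1 := piInner_self_eq_lawVariance_add_sq hπ1 (fun x => |f x|)
    have e3 : piInner π (fun x => |f x|) (fun x => |f x|) = piInner π f f := by
      unfold piInner; exact sum_congr rfl fun x _ => by rw [← sq, sq_abs, sq]
    have h2 := lawMean_abs_sq_le hπ0 hsupp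
    rw [e3] at h1
    nlinarith
  have hsupp' : ∀ x, x ∉ S → (fun x => |f x|) x = 0 := fun x hx => by simp [hsupp x hx]
  have hmain := dirichletEigenvalue_mul_lawVariance_le hπ0 hP0 hsupp' (fun x => abs_nonneg (f x))
  calc (1 - ∑ x ∈ S, π x) * dirichletEigenvalue π P S * piInner π f f
      = dirichletEigenvalue π P S * ((1 - ∑ x ∈ S, π x) * piInner π f f) := by ring
    _ ≤ dirichletEigenvalue π P S * lawVariance π (fun x => |f x|) :=
        mul_le_mul_of_nonneg_left hVabs hlam0
    _ ≤ dirichletForm π P (fun x => |f x|) := hmain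
    _ ≤ dirichletForm π P f := dirichletForm_abs_le hπ0 hP0 f

/-- `𝓔(1_A, 1_A) = ½(Q(A,Aᶜ) + Q(Aᶜ,A))` — the Dirichlet form of an indicator is the symmetrised
boundary flow (`= |∂A| = Q(A,Aᶜ)` for `π` stationary, `Q(A,Aᶜ) = Q(Aᶜ,A)`).
[cite: GoelMontenegroTetali2006, §2.2 proof of Lemma 2.4 ("`λ₀(A) ≤ 𝓔(1_A,1_A)/‖1_A‖₂² =
|∂A|/π(A)`") with Definition 2.1] -/
theorem dirichletForm_setIndicator [DecidableEq X] (π : X → ℝ) (P : Matrix X X ℝ) (A : Finset X) :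
    dirichletForm π P (fun x => if x ∈ A then (1:ℝ) else 0) =
      (1 / 2) * (edgeMeasure π P A Aᶜ + edgeMeasure π P Aᶜ A) := by
  unfold dirichletForm edgeMeasure
  congr 1
  -- split the double sum over `univ × univ` according to membership in `A`
  have hsplit : ∀ g : X → X → ℝ, ∑ x, ∑ y, g x y =
      (∑ x ∈ A, ∑ y ∈ A, g x y + ∑ x ∈ A, ∑ y ∈ Aᶜ, g x y) +
        (∑ x ∈ Aᶜ, ∑ y ∈ A, g x y + ∑ x ∈ Aᶜ, ∑ y ∈ Aᶜ, g x y) := by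
    intro g
    rw [← sum_add_sum_compl A (fun x => ∑ y, g x y)]
    congr 1
    · rw [← sum_add_distrib]; exact sum_congr rfl fun x _ => (sum_add_sum_compl A (g x)).symm
    · rw [← sum_add_distrib]; exact sum_congr rfl fun x _ => (sum_add_sum_compl A (g x)).symm
  rw [hsplit]
  have hAA : ∑ x ∈ A, ∑ y ∈ A, π x * P x y * ((if x ∈ A then (1:ℝ) else 0) - (if y ∈ A then 1 else 0)) ^ 2 = 0 :=
    sum_eq_zero fun x hx => sum_eq_zero fun y hy => by rw [if_pos hx, if_pos hy]; ring
  have hAc : ∑ x ∈ A, ∑ y ∈ Aᶜ, π x * P x y * ((if x ∈ A then (1:ℝ) else 0) - (if y ∈ A then 1 else 0)) ^ 2 =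
      ∑ x ∈ A, ∑ y ∈ Aᶜ, π x * P x y :=
    sum_congr rfl fun x hx => sum_congr rfl fun y hy => by
      rw [if_pos hx, if_neg (mem_compl.1 hy)]; ring
  have hcA : ∑ x ∈ Aᶜ, ∑ y ∈ A, π x * P x y * ((if x ∈ A then (1:ℝ) else 0) - (if y ∈ A then 1 else 0)) ^ 2 =
      ∑ x ∈ Aᶜ, ∑ y ∈ A, π x * P x y :=
    sum_congr rfl fun x hx => sum_congr rfl fun y hy => by
      rw [if_neg (mem_compl.1 hx), if_pos hy]; ring
  have hcc : ∑ x ∈ Aᶜ, ∑ y ∈ Aᶜ, π x * P x y * ((if x ∈ A then (1:ℝ) else 0) - (if y ∈ A then 1 else 0)) ^ 2 = 0 :=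
    sum_eq_zero fun x hx => sum_eq_zero fun y hy => by
      rw [if_neg (mem_compl.1 hx), if_neg (mem_compl.1 hy)]; ring
  rw [hAA, hAc, hcA, hcc]
  ring

/-- **`λ₀(A) ≤ |∂A|/π(A)`** for a non-empty `A` (`π` stationary, `|∂A| = Q(A,Aᶜ)`): the test
function `1_A`. [cite: GoelMontenegroTetali2006, §2.2 proof of Lemma 2.4 (upper bound)] -/
theorem dirichletEigenvalue₀_le_edgeMeasure_div [DecidableEq X] (hπ : ∀ x, 0 < π x)
    (hP : IsRowStochastic P) (hst : IsStationary π P) {A : Finset X} (hA : A.Nonempty) :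
    dirichletEigenvalue₀ π P A ≤ edgeMeasure π P A Aᶜ / ∑ x ∈ A, π x := by
  have hπ0 : ∀ x, 0 ≤ π x := fun x => (hπ x).le
  have hπA : 0 < ∑ x ∈ A, π x := by
    obtain ⟨x₀, hx₀⟩ := hA
    exact lt_of_lt_of_le (hπ x₀) (single_le_sum (fun x _ => hπ0 x) hx₀)
  have hnorm : piInner π (fun x => if x ∈ A then (1:ℝ) else 0) (fun x => if x ∈ A then (1:ℝ) else 0)
      = ∑ x ∈ A, π x := by
    unfold piInner
    rw [← sum_add_sum_compl A]
    have h1 : ∑ x ∈ A, π x * ((if x ∈ A then (1:ℝ) else 0) * (if x ∈ A then 1 else 0)) = ∑ x ∈ A, π x :=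
      sum_congr rfl fun x hx => by rw [if_pos hx]; ring
    have h2 : ∑ x ∈ Aᶜ, π x * ((if x ∈ A then (1:ℝ) else 0) * (if x ∈ A then 1 else 0)) = 0 :=
      sum_eq_zero fun x hx => by rw [if_neg (mem_compl.1 hx)]; ring
    rw [h1, h2, add_zero]
  have h : dirichletEigenvalue₀ π P A ≤
      dirichletForm π P (fun x => if x ∈ A then (1:ℝ) else 0) / ∑ x ∈ A, π x := by
    refine csInf_le ⟨0, by rintro _ ⟨g, ⟨-, hg⟩, rfl⟩; exact div_nonneg (dirichletForm_nonneg hπ0 hP.1 g) hg.le⟩ ?_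
    refine ⟨fun x => if x ∈ A then (1:ℝ) else 0, ⟨fun x hx => if_neg hx, by rw [hnorm]; exact hπA⟩, ?_⟩
    simp only
    rw [hnorm]
  rw [dirichletForm_setIndicator, ← edgeMeasure_compl_comm hP hst A] at h
  refine h.trans (le_of_eq ?_)
  ring

/-- **LEMMA 2.2 (Goel–Montenegro–Tetali 2006), lower bound `λ₁ ≤ Λ(1/2)`** (`|X| ≥ 2`, so that some
non-empty `S` has `π(S) ≤ 1/2`). [cite: GoelMontenegroTetali2006, §2.1 Lemma 2.2] -/
theorem GoelMontenegroTetali2006_lemma_2_2_lower [Nontrivial X] [DecidableEq X] (hπ : ∀ x, 0 < π x)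
    (hπ1 : ∑ x, π x = 1) (hP0 : ∀ x y, 0 ≤ P x y) :
    spectralGapR π P ≤ spectralProfile π P (1 / 2) := by
  refine spectralGapR_le_spectralProfile hπ hπ1 hP0 ?_
  obtain ⟨x, y, hxy⟩ := exists_pair_ne X
  have h2 : π x + π y ≤ 1 := by
    rw [← hπ1, ← sum_pair hxy]
    exact sum_le_univ_sum_of_nonneg fun z => (hπ z).le
  by_cases hx : π x ≤ 1 / 2
  · exact ⟨{x}, singleton_nonempty x, by rw [sum_singleton]; exact hx⟩
  · exact ⟨{y}, singleton_nonempty y, by rw [sum_singleton]; linarith [not_le.1 hx]⟩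

/-- For `f` supported in a set `S` with `π(S) ≤ 1/2`: `𝓔(f,f) ≥ ‖f‖₂²·Λ(1/2)/2`
(`‖f‖₂²λ₀(S) ≤ 𝓔(f,f)`, `λ₀(S) ≥ (1 − π(S))λ(S) ≥ λ(S)/2 ≥ Λ(1/2)/2`).
[cite: GoelMontenegroTetali2006, §2.1 proof of Lemma 2.2 ("`𝓔((f−m)₊,(f−m)₊) ≥
‖(f−m)₊‖₂²λ₀({f > m})`" and "`≥ ‖f−m‖₂² inf_{π(S) ≤ 1/2} λ₀(S) ≥ Var(f)Λ(1/2)/2`")] -/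
theorem piInner_mul_spectralProfile_half_le [DecidableEq X] (hπ : ∀ x, 0 < π x) (hπ1 : ∑ x, π x = 1)
    (hP0 : ∀ x y, 0 ≤ P x y) {S : Finset X} (hS : ∑ x ∈ S, π x ≤ 1 / 2) {f : X → ℝ}
    (hsupp : ∀ x, x ∉ S → f x = 0) :
    piInner π f f * (spectralProfile π P (1 / 2) / 2) ≤ dirichletForm π P f := by
  have hπ0 : ∀ x, 0 ≤ π x := fun x => (hπ x).le
  have hff0 : 0 ≤ piInner π f f := piInner_self_nonneg hπ0 f
  rcases S.eq_empty_or_nonempty with hSe | hSne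
  · -- `f = 0`
    have hf0 : ∀ x, f x = 0 := fun x => hsupp x (by rw [hSe]; exact notMem_empty x)
    have : piInner π f f = 0 := by simp [piInner, hf0]
    rw [this, zero_mul]
    exact dirichletForm_nonneg hπ0 hP0 f
  · have h1 := spectralProfile_le_dirichletEigenvalue hπ0 hP0 hSne hS
    have h2 := one_sub_mul_dirichletEigenvalue_le hπ hπ1 hP0 hSne
    have h3 := dirichletEigenvalue₀_mul_piInner_le hπ0 hP0 hsupp (π := π) (P := P)
    have hlam0 : 0 ≤ dirichletEigenvalue π P S := dirichletEigenvalue_nonneg hπ0 hP0 S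
    have h4 : spectralProfile π P (1 / 2) / 2 ≤ dirichletEigenvalue₀ π P S := by
      calc spectralProfile π P (1 / 2) / 2 ≤ dirichletEigenvalue π P S / 2 := by linarith
        _ ≤ (1 - ∑ x ∈ S, π x) * dirichletEigenvalue π P S := by nlinarith
        _ ≤ dirichletEigenvalue₀ π P S := h2
    calc piInner π f f * (spectralProfile π P (1 / 2) / 2)
        ≤ piInner π f f * dirichletEigenvalue₀ π P S := mul_le_mul_of_nonneg_left h4 hff0
      _ = dirichletEigenvalue₀ π P S * piInner π f f := mul_comm _ _
      _ ≤ dirichletForm π P f := h3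

/-- **LEMMA 2.2 (Goel–Montenegro–Tetali 2006), the Poincaré form of the upper bound:
`𝓔(f,f) ≥ Var(f)·Λ(1/2)/2` for every `f`** (split `f − m` at a median `m` into its positive and
negative parts, each supported on a set of mass `≤ 1/2`). [cite: GoelMontenegroTetali2006, §2.1
Lemma 2.2 (proof)] -/
theorem lawVariance_mul_spectralProfile_half_le [DecidableEq X] (hπ : ∀ x, 0 < π x)
    (hπ1 : ∑ x, π x = 1) (hP0 : ∀ x y, 0 ≤ P x y) (f : X → ℝ) :
    lawVariance π f * (spectralProfile π P (1 / 2) / 2) ≤ dirichletForm π P f := by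
  have hπ0 : ∀ x, 0 ≤ π x := fun x => (hπ x).le
  obtain ⟨m, hgt, hlt⟩ := exists_median hπ1 f
  have hΛ0 : 0 ≤ spectralProfile π P (1 / 2) / 2 := by
    have := spectralProfile_nonneg hπ0 hP0 (1 / 2) (π := π) (P := P); linarith
  -- positive part, supported in `{f > m}`
  have hpos := piInner_mul_spectralProfile_half_le hπ hπ1 hP0 hgt (f := fun x => max (f x - m) 0)
    (fun x hx => by
      have : ¬ m < f x := fun h => hx (mem_filter.2 ⟨mem_univ x, h⟩)
      exact max_eq_right (by linarith [not_lt.1 this]))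
  -- negative part `min(f − m, 0)`, supported in `{f < m}`
  have hneg := piInner_mul_spectralProfile_half_le hπ hπ1 hP0 hlt (f := fun x => min (f x - m) 0)
    (fun x hx => by
      have : ¬ f x < m := fun h => hx (mem_filter.2 ⟨mem_univ x, h⟩)
      exact min_eq_right (by linarith [not_lt.1 this]))
  have hsplit := dirichletForm_posPart_add_dirichletForm_min_le hπ0 hP0 (fun x => f x - m)
  rw [dirichletForm_sub_const] at hsplit
  -- `‖(f−m)₊‖² + ‖min(f−m,0)‖² = ‖f − m‖² ≥ Var(f)`
  have hnorm : piInner π (fun x => max (f x - m) 0) (fun x => max (f x - m) 0) +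
      piInner π (fun x => min (f x - m) 0) (fun x => min (f x - m) 0) =
      piInner π (fun x => f x - m) (fun x => f x - m) := by
    unfold piInner
    rw [← sum_add_distrib]
    refine sum_congr rfl fun x _ => ?_
    dsimp only
    rcases le_total 0 (f x - m) with h | h
    · rw [max_eq_left h, min_eq_right h]; ring
    · rw [max_eq_right h, min_eq_left h]; ring
  have hvar : lawVariance π f ≤ piInner π (fun x => f x - m) (fun x => f x - m) := by
    rw [piInner_sub_const_eq hπ1 f m]; nlinarith [sq_nonneg (lawMean π f - m)]
  calc lawVariance π f * (spectralProfile π P (1 / 2) / 2)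
      ≤ piInner π (fun x => f x - m) (fun x => f x - m) * (spectralProfile π P (1 / 2) / 2) :=
        mul_le_mul_of_nonneg_right hvar hΛ0
    _ = piInner π (fun x => max (f x - m) 0) (fun x => max (f x - m) 0) * (spectralProfile π P (1 / 2) / 2) +
        piInner π (fun x => min (f x - m) 0) (fun x => min (f x - m) 0) * (spectralProfile π P (1 / 2) / 2) := by
        rw [← hnorm]; ring
    _ ≤ dirichletForm π P (fun x => max (f x - m) 0) + dirichletForm π P (fun x => min (f x - m) 0) :=
        add_le_add hpos hneg
    _ ≤ dirichletForm π P f := hsplit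

/-- **LEMMA 2.2 (Goel–Montenegro–Tetali 2006): `λ₁ ≤ Λ(1/2) ≤ 2λ₁`**, upper bound
("The upper bound follows by minimizing over `f`"; `λ₁ = spectralGapR`, `|X| ≥ 2`).
[cite: GoelMontenegroTetali2006, §2.1 Lemma 2.2] -/
theorem GoelMontenegroTetali2006_lemma_2_2_upper [Nontrivial X] [DecidableEq X] (hπ : ∀ x, 0 < π x)
    (hπ1 : ∑ x, π x = 1) (hP0 : ∀ x y, 0 ≤ P x y) :
    spectralProfile π P (1 / 2) ≤ 2 * spectralGapR π P := by
  -- the constraint set of `λ₁` is non-empty on a space with two points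
  obtain ⟨x, y, hxy⟩ := exists_pair_ne X
  have h2 : π x + π y ≤ 1 := by
    rw [← hπ1, ← sum_pair hxy]
    exact sum_le_univ_sum_of_nonneg fun z => (hπ z).le
  have hX : ∃ S : Finset X, 0 < ∑ z ∈ S, π z ∧ ∑ z ∈ S, π z ≤ 1 / 2 := by
    by_cases hx : π x ≤ 1 / 2
    · exact ⟨{x}, by rw [sum_singleton]; exact hπ x, by rw [sum_singleton]; exact hx⟩
    · exact ⟨{y}, by rw [sum_singleton]; exact hπ y, by rw [sum_singleton]; linarith [not_le.1 hx]⟩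
  obtain ⟨g₀, hg₀⟩ := exists_mean_zero_piInner_one hπ1 hX
  suffices h : spectralProfile π P (1 / 2) / 2 ≤ spectralGapR π P by linarith
  refine le_csInf ⟨_, ⟨g₀, hg₀, rfl⟩⟩ ?_
  rintro _ ⟨f, ⟨hf0, hf1⟩, rfl⟩
  have hV : lawVariance π f = 1 := by
    rw [← piInner_self_eq_lawVariance_of_lawMean_eq_zero (π := π) (g := f) hf0, hf1]
  have h := lawVariance_mul_spectralProfile_half_le hπ hπ1 hP0 f (P := P)
  rw [hV, one_mul] at h
  exact h

end Comparison

/-! ## §2.2: the conductance profile and the easy half `Λ(r) ≤ Φ(r)/(1 − r)` of Lemma 2.4 -/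

section Conductance

variable [DecidableEq X]

/-- **DEFINITION 2.2** (Goel–Montenegro–Tetali): the CONDUCTANCE PROFILE
`Φ(r) = inf_{π_* ≤ π(S) ≤ r} |∂S|/π(S)`, `|∂S| = Q(S,Sᶜ)` (the tree's `bottleneckRatio π P S =
Q(S,Sᶜ)/π(S)`; real infimum over the non-empty `S` with `π(S) ≤ r`, `0` if there is none).
[cite: GoelMontenegroTetali2006, §2.2 Definitions 2.1–2.2] -/
noncomputable def conductanceProfile (π : X → ℝ) (P : Matrix X X ℝ) (r : ℝ) : ℝ :=
  sInf ((fun S : Finset X => bottleneckRatio π P S) '' {S | S.Nonempty ∧ ∑ x ∈ S, π x ≤ r})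

/-- **LEMMA 2.4 (Goel–Montenegro–Tetali 2006), upper bound: `Λ(r) ≤ Φ(r)/(1 − r)`** for
`π_* ≤ r < 1` (some non-empty `S` has `π(S) ≤ r`), typed as `(1 − r)Λ(r) ≤ Φ(r)`; from
`λ(S) ≤ λ₀(S)/(1 − π(S))` and `λ₀(S) ≤ |∂S|/π(S)`.  (The lower bound `Φ(r)²/2 ≤ Λ(r)`, a Cheeger
inequality for the restricted eigenvalues `λ₀(S)` via the co-area formula, is not typed here.)
[cite: GoelMontenegroTetali2006, §2.2 Lemma 2.4 (upper bound and its proof)] -/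
theorem GoelMontenegroTetali2006_lemma_2_4_upper (hπ : ∀ x, 0 < π x) (hπ1 : ∑ x, π x = 1)
    (hP : IsRowStochastic P) (hst : IsStationary π P) {r : ℝ} (hr1 : r < 1)
    (hr : ∃ S : Finset X, S.Nonempty ∧ ∑ x ∈ S, π x ≤ r) :
    (1 - r) * spectralProfile π P r ≤ conductanceProfile π P r := by
  have hπ0 : ∀ x, 0 ≤ π x := fun x => (hπ x).le
  obtain ⟨S₀, hS₀, hS₀r⟩ := hr
  refine le_csInf ⟨_, ⟨S₀, ⟨hS₀, hS₀r⟩, rfl⟩⟩ ?_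
  rintro _ ⟨S, ⟨hS, hSr⟩, rfl⟩
  have hΛ := spectralProfile_le_dirichletEigenvalue hπ0 hP.1 hS hSr (π := π) (P := P)
  have hΛ0 := spectralProfile_nonneg hπ0 hP.1 r (π := π) (P := P)
  have h1 := one_sub_mul_dirichletEigenvalue_le hπ hπ1 hP.1 hS (P := P)
  have h2 := dirichletEigenvalue₀_le_edgeMeasure_div hπ hP hst hS
  have hπS1 : 1 - r ≤ 1 - ∑ x ∈ S, π x := by linarith
  calc (1 - r) * spectralProfile π P r ≤ (1 - ∑ x ∈ S, π x) * spectralProfile π P r :=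
        mul_le_mul_of_nonneg_right hπS1 hΛ0
    _ ≤ (1 - ∑ x ∈ S, π x) * dirichletEigenvalue π P S :=
        mul_le_mul_of_nonneg_left hΛ (by linarith)
    _ ≤ dirichletEigenvalue₀ π P S := h1
    _ ≤ edgeMeasure π P S Sᶜ / ∑ x ∈ S, π x := h2
    _ = bottleneckRatio π P S := rfl

end Conductance

end Literature.Probability.MarkovChains
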